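import Summits.CriticalPhenomena.CardyFormulaZ2.Theorems.CardyBondTriangularBondTriangularCardyCofillCore
import Summits.CriticalPhenomena.CardyFormulaZ2.Theorems.CardyBondTriangularBondTriangularCardyCofillLevel
import HarnessLib

/-!
# Route CardyBondTriangular · crux `BondTriangularCardy` (stmt-CriticalPhenomena-4664), line `birth`:
# the stub `stub_cofillGeometry` (D1 with cofill)

Proof of the registered stub `stub_cofillGeometry : Sig.stub_cofillGeometry` of reshape v5 of the
line `birth` (`…CardyCofillCore.lean`): the model-free geometry of Bollobás–Riordan's Lemma 14
(*Percolation*, CUP 2006, Ch. 7, p. 184) — two families `G_δ⁻`, `G_δ⁺` of 4-marked discrete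
domains of `δ𝕋` which are discrete approximations of the conformal rectangle `R`
(`IsDiscreteApprox`) and eventually longer–thinner, resp. shorter–fatter, at every `(t, ρ)` (the
landed `discreteDomains_geometry` of `…CardyDomainsGeometry.lean`) — together with the two COFILL
clauses for `G_δ⁺`: for every `ρ > 0`, `κ > 0`, eventually as `δ → 0⁺`, every hexagon whose centre
is within `2δ` of `Ω`, `ρ`-far from the corners and `κ`-far from `A₀ ∪ A₂`, is a site of `G_δ⁺`,
and every `ρ`-far site of `G_δ⁺` is farther than `2δ` from `A₀ ∪ A₂`.

The proof is the diagonal assembly of `discreteDomains_geometry` verbatim (per-level predicate,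
`exists_scale_tendsto`, the local connectivity of Claim 21 through `site_conn_collar` /
`face_conn_collar`, `isDiscreteApprox_of_levelProp`), with the level-`ε` package of `G⁺` taken
from `level_geometry_cofill` (`…CardyCofillLevel.lean`), which adds the two clauses at
`(ρ, κ) = (ε, ε)`; they are monotone in `(ρ, κ)`, so on the diagonal `ε(δ) → 0` they hold at any
given `(ρ, κ)` eventually.

References: B. Bollobás, O. Riordan, *Percolation*, CUP 2006, Ch. 7, Lemma 14 p. 184, (28)–(29)
p. 192, Claim 21 p. 193, p. 195, (31)–(34) pp. 196–199.
-/

noncomputable section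

namespace Summit.CriticalPhenomena.CardyFormulaZ2.Theorems.BondTriangularCardyLine

open Set Filter Topology Metric
open Literature.Probability.Percolation Literature.Probability.RandomPlanarGeometry
open Literature.Probability.LatticeModels

/-- **Stub `stub_cofillGeometry` (D1 with cofill): the model-free geometry of Lemma 14 together
with the cofill clauses of the shorter–fatter family.** For a conformal rectangle with an
anticlockwise Carleson datum there are families `G_δ⁻`, `G_δ⁺` of 4-marked discrete domains of
`δ𝕋` which are discrete approximations of `R` (`IsDiscreteApprox`), eventually longer–thinner,
resp. shorter–fatter, at every `(t, ρ)`, and such that `G_δ⁺` is cofilled: for every `ρ > 0` and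
`κ > 0`, eventually as `δ → 0⁺`, every hexagon with centre within `2δ` of `Ω`, at distance `≥ ρ`
from the corners and `≥ κ` from `A₀` and from `A₂`, is a site of `G_δ⁺`, and every site of `G_δ⁺`
at distance `≥ ρ` from the corners is farther than `2δ` from `A₀` and from `A₂`. Proof: the
diagonal assembly of `discreteDomains_geometry` (Bollobás–Riordan's construction, *Percolation*,
CUP 2006, Ch. 7, Lemma 14 p. 184, (28)–(29) p. 192, Claim 21 p. 193, p. 195, (31)–(34)
pp. 196–199: marked inner approximations of the collar domains at a diagonal level `ε(δ) → 0`,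
`exists_scale_tendsto`, local connectivity through `site_conn_collar` / `face_conn_collar`) with
the per-level predicate enriched, for `G⁺`, by the two clauses of `level_geometry_cofill` at
`(ρ, κ) = (ε, ε)`; on the diagonal, for given `ρ, κ > 0`, eventually `ε(δ) < min ρ κ` and the
clauses are monotone in `(ρ, κ)`. -/
theorem stub_cofillGeometry : Sig.stub_cofillGeometry := by
  classical
  intro R a b c d ψ habc hd hψ hturn
  have hR1 : ∀ z ∈ R.carrier, R.index z = 1 := fun z hz => index_eq_one_of_isCarlesonMap R ψ habc hψ hturn hz
  obtain ⟨T⟩ := R.toJordanDomain.nonempty_tubeData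
  -- local connectivity data at the scales `γ_k = 1/(k+1)` (Claim 21, uniform in the level)
  have hc : ∀ γ > (0 : ℝ), ∃ η > (0 : ℝ), ∃ ε₁ > (0 : ℝ), ∀ (σ : Fin 4 → ℝ) (hσ1 : ∀ i, σ i = 1 ∨ σ i = -1) (h : ℝ) (hh : 0 < h)
      (hh1 : h ≤ 1 / 2), h ≤ ε₁ → T.z₀ ∈ (R.collarRect T (MarkedDomain.abs_le_one_of_sign hσ1) hh hh1).carrier →
      ∃ δ₁ > (0 : ℝ), ∀ (δ : ℝ) (hδ : 0 < δ)
        (hc₀ : baseSite T.z₀ δ ∈ innerCoarse (R.collarRect T (MarkedDomain.abs_le_one_of_sign hσ1) hh hh1).carrier δ), δ < δ₁ →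
        (∀ x ∈ (innerApprox (R.collarRect T (MarkedDomain.abs_le_one_of_sign hσ1) hh hh1).toJordanDomain hδ hc₀).verts,
          ∀ y ∈ (innerApprox (R.collarRect T (MarkedDomain.abs_le_one_of_sign hσ1) hh hh1).toJordanDomain hδ hc₀).verts,
            dist (triMeshPoint δ x) (triMeshPoint δ y) < η →
            PathIn triGraph (((innerApprox (R.collarRect T (MarkedDomain.abs_le_one_of_sign hσ1) hh hh1).toJordanDomain hδ hc₀).verts :
              Set (Site 2)) ∩ {v | dist (triMeshPoint δ x) (triMeshPoint δ v) < γ}) x y) ∧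
        (∀ w ∈ triFacesIn (innerApprox (R.collarRect T (MarkedDomain.abs_le_one_of_sign hσ1) hh hh1).toJordanDomain hδ hc₀).verts,
          ∀ z ∈ triFacesIn (innerApprox (R.collarRect T (MarkedDomain.abs_le_one_of_sign hσ1) hh hh1).toJordanDomain hδ hc₀).verts,
            dist ((δ : ℂ) * hexCenter w) ((δ : ℂ) * hexCenter z) < η →
            Relation.ReflTransGen (fun F F' : HexVertex => hexGraph.Adj F F' ∧
              F' ∈ triFacesIn (innerApprox (R.collarRect T (MarkedDomain.abs_le_one_of_sign hσ1) hh hh1).toJordanDomain hδ hc₀).verts ∧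
              dist ((δ : ℂ) * hexCenter w) ((δ : ℂ) * hexCenter F') < 2 * γ) w z) := by
    intro γ hγ
    obtain ⟨ηs, hηs, hsite⟩ := site_conn_collar R T hγ
    obtain ⟨ηf, hηf, hface⟩ := face_conn_collar R T hγ
    refine ⟨min ηs ηf, lt_min hηs hηf, 1, one_pos, fun σ hσ1 h hh hh1 _ _ => ⟨min ηs ηf, lt_min hηs hηf, fun δ hδ hc₀ hδlt => ⟨?_, ?_⟩⟩⟩
    · intro x hx y hy hxy
      exact hsite σ _ h hh hh1 δ hδ hc₀ (hδlt.trans_le (min_le_left _ _)) x hx y hy (hxy.trans_le (min_le_left _ _))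
    · intro w hw z hz hwz
      exact hface σ _ h hh hh1 δ hδ hc₀ (hδlt.trans_le (min_le_right _ _)) w hw z hz (hwz.trans_le (min_le_right _ _))
  choose η hη ε₁ hε₁ hck using fun k : ℕ => hc (1 / ((k : ℝ) + 1)) (by positivity)
  set θ : ℕ → ℝ := fun k => min (ε₁ k) (1 / ((k : ℝ) + 1)) with hθ
  have hθ0 : ∀ k, 0 < θ k := fun k => lt_min (hε₁ k) (by positivity)
  -- the per-level predicate: level-`ε` approximation properties, the level-`ε` geometry and, for
  -- `G⁺`, the cofill clauses at `(ρ, κ) = (ε, ε)`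
  set P : ℝ → ℝ → Prop := fun ε δ => ∃ Gm Gp : TriMarkedDomain 4,
    (LevelProp R T η θ ε δ Gm ∧ Gm.IsLongerThinner R δ (2 * ε) ε) ∧
    (LevelProp R T η θ ε δ Gp ∧ Gp.IsShorterFatter R δ (2 * ε) ε) ∧
    ((∀ x : Site 2, infDist (triMeshPoint δ x) R.carrier ≤ 2 * δ → (∀ j, ε ≤ dist (triMeshPoint δ x) (R.pt j)) →
        ε ≤ infDist (triMeshPoint δ x) (R.arc 0) → ε ≤ infDist (triMeshPoint δ x) (R.arc 2) → x ∈ Gp.verts) ∧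
      (∀ x ∈ Gp.verts, (∀ j, ε ≤ dist (triMeshPoint δ x) (R.pt j)) →
        2 * δ < infDist (triMeshPoint δ x) (R.arc 0) ∧ 2 * δ < infDist (triMeshPoint δ x) (R.arc 2))) with hP
  have hPall : ∀ ε > 0, ∃ δ₀ > 0, ∀ δ, 0 < δ → δ < δ₀ → P ε δ := by
    intro ε hε
    obtain ⟨hm, hhm, hhm1, hmε, hz₀m, δm, hδm, hlevm⟩ := level_geometry R T σm_sign hR1 hε
    obtain ⟨hp, hhp, hhp1, hpε, hz₀p, δp, hδp, hlevp⟩ := level_geometry_cofill R T hR1 ε hε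
    -- connectivity thresholds for the finitely many relevant `k`
    have hkN : ∀ k : ℕ, ε ≤ θ k → k < ⌈1 / ε⌉₊ + 1 := by
      intro k hk
      have h1 : ε ≤ 1 / ((k : ℝ) + 1) := hk.trans (min_le_right _ _)
      have h2 : (k : ℝ) + 1 ≤ 1 / ε := by
        rw [le_div_iff₀ hε]; rw [le_div_iff₀ (by positivity)] at h1; linarith
      have h3 : (k : ℝ) < ⌈1 / ε⌉₊ + 1 := by linarith [Nat.le_ceil (1 / ε)]
      exact_mod_cast h3
    have hdm : ∀ k, ∃ d > (0 : ℝ), ε ≤ θ k → ∀ (δ : ℝ) (hδ : 0 < δ)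
        (hc₀ : baseSite T.z₀ δ ∈ innerCoarse (R.collarRect T (MarkedDomain.abs_le_one_of_sign σm_sign) hhm hhm1).carrier δ), δ < d → _ :=
      fun k => by
        by_cases hk : ε ≤ θ k
        · obtain ⟨δ₁, hδ₁, h⟩ := hck k σm σm_sign hm hhm hhm1 (hmε.trans (hk.trans (min_le_left _ _))) hz₀m
          exact ⟨δ₁, hδ₁, fun _ => h⟩
        · exact ⟨1, one_pos, fun h => absurd h hk⟩
    choose dm hdm0 hdmk using hdm
    have hdp : ∀ k, ∃ d > (0 : ℝ), ε ≤ θ k → ∀ (δ : ℝ) (hδ : 0 < δ)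
        (hc₀ : baseSite T.z₀ δ ∈ innerCoarse (R.collarRect T (MarkedDomain.abs_le_one_of_sign σp_sign) hhp hhp1).carrier δ), δ < d → _ :=
      fun k => by
        by_cases hk : ε ≤ θ k
        · obtain ⟨δ₁, hδ₁, h⟩ := hck k σp σp_sign hp hhp hhp1 (hpε.trans (hk.trans (min_le_left _ _))) hz₀p
          exact ⟨δ₁, hδ₁, fun _ => h⟩
        · exact ⟨1, one_pos, fun h => absurd h hk⟩
    choose dp hdp0 hdpk using hdp
    obtain ⟨Dm, hDm, hDmk⟩ := exists_pos_le_forall_lt hdm0 (⌈1 / ε⌉₊ + 1)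
    obtain ⟨Dp, hDp, hDpk⟩ := exists_pos_le_forall_lt hdp0 (⌈1 / ε⌉₊ + 1)
    refine ⟨min (min δm δp) (min Dm Dp), by positivity, fun δ hδ hδlt => ?_⟩
    have hδm' : δ < δm := hδlt.trans_le ((min_le_left _ _).trans (min_le_left _ _))
    have hδp' : δ < δp := hδlt.trans_le ((min_le_left _ _).trans (min_le_right _ _))
    have hδDm : δ < Dm := hδlt.trans_le ((min_le_right _ _).trans (min_le_left _ _))
    have hδDp : δ < Dp := hδlt.trans_le ((min_le_right _ _).trans (min_le_right _ _))
    obtain ⟨hc₀m, Gm, hGmv, harcm, H1m, H2m, H3m, hfillm, hdensem⟩ := hlevm δ hδ hδm'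
    obtain ⟨hc₀p, Gp, hGpv, harcp, H1p, H2p, H3p, hfillp, hdensep, hcofill, hcofar⟩ := hlevp δ hδ hδp'
    refine ⟨Gm, Gp, ⟨⟨harcm, hfillm, hdensem, fun k hk => ?_⟩,
        isLongerThinner_of_level R hε (fun i => (harcm i).1) H1m H2m H3m⟩,
      ⟨⟨harcp, hfillp, hdensep, fun k hk => ?_⟩, isShorterFatter_of_level R hε (fun i => (harcp i).1) H1p H2p H3p⟩,
      hcofill, hcofar⟩
    · have := hdmk k hk δ hδ hc₀m ((hδDm.trans_le (hDmk k (hkN k hk))))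
      rw [← hGmv] at this
      exact this
    · have := hdpk k hk δ hδ hc₀p ((hδDp.trans_le (hDpk k (hkN k hk))))
      rw [← hGpv] at this
      exact this
  obtain ⟨e, he, hepos, heP⟩ := exists_scale_tendsto hPall
  -- the families
  obtain ⟨δs, hδs⟩ := heP.exists
  set G₀ : TriMarkedDomain 4 := hδs.choose with hG₀
  set Gm : ℝ → TriMarkedDomain 4 := fun δ => if hPδ : P (e δ) δ then hPδ.choose else G₀ with hGm
  set Gp : ℝ → TriMarkedDomain 4 := fun δ => if hPδ : P (e δ) δ then hPδ.choose_spec.choose else G₀ with hGp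
  have hspec : ∀ δ, P (e δ) δ →
      (LevelProp R T η θ (e δ) δ (Gm δ) ∧ (Gm δ).IsLongerThinner R δ (2 * e δ) (e δ)) ∧
      (LevelProp R T η θ (e δ) δ (Gp δ) ∧ (Gp δ).IsShorterFatter R δ (2 * e δ) (e δ)) ∧
      ((∀ x : Site 2, infDist (triMeshPoint δ x) R.carrier ≤ 2 * δ → (∀ j, e δ ≤ dist (triMeshPoint δ x) (R.pt j)) →
          e δ ≤ infDist (triMeshPoint δ x) (R.arc 0) → e δ ≤ infDist (triMeshPoint δ x) (R.arc 2) → x ∈ (Gp δ).verts) ∧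
        (∀ x ∈ (Gp δ).verts, (∀ j, e δ ≤ dist (triMeshPoint δ x) (R.pt j)) →
          2 * δ < infDist (triMeshPoint δ x) (R.arc 0) ∧ 2 * δ < infDist (triMeshPoint δ x) (R.arc 2))) := by
    intro δ hPδ
    have h1 : Gm δ = hPδ.choose := by simp only [hGm, dif_pos hPδ]
    have h2 : Gp δ = hPδ.choose_spec.choose := by simp only [hGp, dif_pos hPδ]
    rw [h1, h2]
    exact hPδ.choose_spec.choose_spec
  -- eventual smallness of `e`
  have hsmall : ∀ c > 0, ∀ᶠ δ in 𝓝[>] (0 : ℝ), e δ < c := fun c hc => he (Iio_mem_nhds hc)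
  refine ⟨Gm, Gp, isDiscreteApprox_of_levelProp R T hη hθ0 he Gm (heP.mono fun δ hδ => (hspec δ hδ).1.1),
    isDiscreteApprox_of_levelProp R T hη hθ0 he Gp (heP.mono fun δ hδ => (hspec δ hδ).2.1.1),
    fun ρ hρ t ht => ?_, fun ρ hρ t ht => ?_, fun ρ hρ κ hκ => ?_⟩
  · filter_upwards [heP, hsmall (min ρ (t / 2)) (by positivity)] with δ hδ hδs
    have h1 : e δ < ρ := hδs.trans_le (min_le_left _ _)
    have h2 : e δ < t / 2 := hδs.trans_le (min_le_right _ _)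
    exact (hspec δ hδ).1.2.mono (by linarith) h1.le
  · filter_upwards [heP, hsmall (min ρ (t / 2)) (by positivity)] with δ hδ hδs
    have h1 : e δ < ρ := hδs.trans_le (min_le_left _ _)
    have h2 : e δ < t / 2 := hδs.trans_le (min_le_right _ _)
    exact (hspec δ hδ).2.1.2.mono (by linarith) h1.le
  · filter_upwards [heP, hsmall (min ρ κ) (lt_min hρ hκ)] with δ hδ hδs
    have h1 : e δ ≤ ρ := (hδs.trans_le (min_le_left _ _)).le
    have h2 : e δ ≤ κ := (hδs.trans_le (min_le_right _ _)).le
    obtain ⟨hco, hfa⟩ := (hspec δ hδ).2.2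
    exact ⟨fun x hx hfar h0 h2' => hco x hx (fun j => h1.trans (hfar j)) (h2.trans h0) (h2.trans h2'),
      fun x hx hfar => hfa x hx fun j => h1.trans (hfar j)⟩

end Summit.CriticalPhenomena.CardyFormulaZ2.Theorems.BondTriangularCardyLine

end
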